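import Mathlib
import Summits.KontsevichZagierPeriods.KontsevichZagierPeriods.Theorems.SoloInformedSidePieces
import Summits.KontsevichZagierPeriods.KontsevichZagierPeriods.Theorems.SoloInformedBandFibreBound
import Summits.KontsevichZagierPeriods.KontsevichZagierPeriods.Theorems.SoloInformedBandTonelli
import Summits.KontsevichZagierPeriods.KontsevichZagierPeriods.Theorems.SoloInformedPreparedCover
import Literature.NumberTheory.Transcendental.KZSemialgebraicComplex
import HarnessLib

/-!
# Solo-informed (A390-ii): the hypothesis bundle over the base of a prepared band

File F4g of the KERNEL LEMMA I programme.  For a band `D = bandOver B ξ j` over a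
`ℚ`-semialgebraic base with `ℚ`-semialgebraic sections, on which `F` and the family `ρᵢ` carry
Lion–Rolin data `d₀`, `dᵢ`, we define the fibre quantities

* `soloInformedBandHW B ξ j H w = ∫ D.indicator H (w, y) dy` (for the weighted integrand `H` and
  the mass integrand `H₀`), `soloInformedBandI d₀ w = ∫_{J(w)} |y − θ w|^r dy`,

prove their measurability and the splitting `∫ D.indicator H (t, x) dx = ∫ HW (t, x') dx'`, the
semialgebraicity of the recentred endpoints and of the weight family `σ`, and assemble the bundle
`SoloInformedSideHyp B …` (file `SoloInformedSidePieces`) from the fibre bound (file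
`SoloInformedBandFibreBound`).
-/

open MeasureTheory Set Real
open scoped ENNReal
open Literature.ModelTheory.ExponentialFields Literature.NumberTheory.Transcendental

namespace Summit.KontsevichZagierPeriods.KontsevichZagierPeriods.Theorems

variable {n l : ℕ} {B : Set (Fin n → ℝ)} {ξ : Fin l → (Fin n → ℝ) → ℝ} {j : Fin (l + 1)}

/-! ### Fibre quantities -/

/-- The fibre integral `w ↦ ∫ D.indicator H (w, y) dy` of an integrand over the band `D`. -/
noncomputable def soloInformedBandHW (B : Set (Fin n → ℝ)) (ξ : Fin l → (Fin n → ℝ) → ℝ)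
    (j : Fin (l + 1)) (H : (Fin (n + 1) → ℝ) → ℝ≥0∞) (w : Fin n → ℝ) : ℝ≥0∞ :=
  ∫⁻ y, (bandOver B ξ j).indicator H (Fin.snoc w y)

/-- The normalised power integral `I(w) = ∫_{J(w)} |y − θ w|^r dy` of Lion–Rolin data. -/
noncomputable def soloInformedBandI {F : (Fin (n + 1) → ℝ) → ℝ}
    (d₀ : SoloInformedLRData B (bandOver B ξ j) F) (w : Fin n → ℝ) : ℝ≥0∞ :=
  ∫⁻ y in soloInformedEIoo (bandLower ξ j w) (bandUpper ξ j w),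
    ENNReal.ofReal (|y - d₀.θ w| ^ (d₀.r : ℝ))

/-- Measurability of the fibre integral. -/
theorem soloInformed_measurable_bandHW (hD : MeasurableSet (bandOver B ξ j))
    {H : (Fin (n + 1) → ℝ) → ℝ≥0∞} (hH : Measurable H) :
    Measurable (soloInformedBandHW B ξ j H) :=
  soloInformed_measurable_lintegral_snoc (hH.indicator hD)

/-- Over a base point, the fibre integral is the integral over the fibre interval of any function
agreeing with `H` on the band. -/
theorem soloInformed_bandHW_congr {H G : (Fin (n + 1) → ℝ) → ℝ≥0∞}
    (hHG : ∀ z ∈ bandOver B ξ j, H z = G z) {w : Fin n → ℝ} (hw : w ∈ B) :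
    soloInformedBandHW B ξ j H w =
      ∫⁻ y in soloInformedEIoo (bandLower ξ j w) (bandUpper ξ j w), G (Fin.snoc w y) := by
  unfold soloInformedBandHW
  rw [soloInformed_lintegral_bandOver_snoc, indicator_of_mem hw]
  refine setLIntegral_congr_fun (soloInformed_measurableSet_EIoo _ _) fun y hy => hHG _ ?_
  exact snoc_mem_bandOver_iff.mpr ⟨hw, hy.1, hy.2⟩

/-- Off the base the fibre integral vanishes. -/
theorem soloInformed_bandHW_of_notMem (H : (Fin (n + 1) → ℝ) → ℝ≥0∞) {w : Fin n → ℝ}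
    (hw : w ∉ B) : soloInformedBandHW B ξ j H w = 0 := by
  unfold soloInformedBandHW
  rw [soloInformed_lintegral_bandOver_snoc, indicator_of_notMem hw]

/-- The fibre integral is supported on the base. -/
theorem soloInformed_bandHW_eq_indicator (H : (Fin (n + 1) → ℝ) → ℝ≥0∞) :
    soloInformedBandHW B ξ j H = B.indicator (soloInformedBandHW B ξ j H) := by
  funext w
  by_cases hw : w ∈ B
  · rw [indicator_of_mem hw]
  · rw [indicator_of_notMem hw, soloInformed_bandHW_of_notMem H hw]

/-- Splitting off the last variable under a parameter block:
`∫ D.indicator H (t, x) dx = ∫ HW (t, x') dx'`. -/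
theorem soloInformed_lintegral_band_append {k m : ℕ} {B : Set (Fin (k + m) → ℝ)}
    {ξ : Fin l → (Fin (k + m) → ℝ) → ℝ} {j : Fin (l + 1)} (hD : MeasurableSet (bandOver B ξ j))
    {H : (Fin (k + m + 1) → ℝ) → ℝ≥0∞} (hH : Measurable H) (t : Fin k → ℝ) :
    ∫⁻ x : Fin (m + 1) → ℝ, (bandOver B ξ j).indicator H (Fin.append t x : Fin (k + (m + 1)) → ℝ) =
      ∫⁻ x' : Fin m → ℝ, soloInformedBandHW B ξ j H (Fin.append t x') :=
  soloInformed_lintegral_indicator_append_finSucc hD hH t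

/-! ### Semialgebraicity of the endpoint data and of the weights -/

/-- `w ↦ (bandLower ξ j w).toReal` is `ℚ`-semialgebraic on the base. -/
theorem soloInformed_sa_bandLower_toReal (hB : IsSemialgebraic ℚ B)
    (hξ : ∀ i, IsSemialgebraicFunOn ℚ B (ξ i)) (j : Fin (l + 1)) :
    IsSemialgebraicFunOn ℚ B (fun w => (bandLower ξ j w).toReal) := by
  by_cases hj : j = 0
  · subst hj
    exact (isSemialgebraicFunOn_const_of_isAlgebraic hB isAlgebraic_zero).congr fun w _ => by
      simp
  · exact (hξ (j.pred hj)).congr fun w _ => by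
      simp only [bandLower_of_ne_zero ξ j hj, EReal.toReal_coe]

/-- `w ↦ (bandUpper ξ j w).toReal` is `ℚ`-semialgebraic on the base. -/
theorem soloInformed_sa_bandUpper_toReal (hB : IsSemialgebraic ℚ B)
    (hξ : ∀ i, IsSemialgebraicFunOn ℚ B (ξ i)) (j : Fin (l + 1)) :
    IsSemialgebraicFunOn ℚ B (fun w => (bandUpper ξ j w).toReal) := by
  by_cases hj : j = Fin.last l
  · subst hj
    exact (isSemialgebraicFunOn_const_of_isAlgebraic hB isAlgebraic_zero).congr fun w _ => by
      simp
  · exact (hξ (j.castPred hj)).congr fun w _ => by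
      simp only [bandUpper_of_ne_last ξ j hj, EReal.toReal_coe]

variable {F : (Fin (n + 1) → ℝ) → ℝ} {ι : Type} [Fintype ι] {ρ : ι → (Fin (n + 1) → ℝ) → ℝ}

omit [Fintype ι] in
/-- The weights `σ` are `ℚ`-semialgebraic on the base. -/
theorem soloInformed_sa_bandSigma (hB : IsSemialgebraic ℚ B)
    (hξ : ∀ i, IsSemialgebraicFunOn ℚ B (ξ i)) (d₀ : SoloInformedLRData B (bandOver B ξ j) F)
    (d : ∀ i, SoloInformedLRData B (bandOver B ξ j) (ρ i)) :
    ∀ x, IsSemialgebraicFunOn ℚ B (soloInformedBandSigma d₀ d x) := by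
  have hlo := soloInformed_sa_bandLower_toReal hB hξ j
  have hup := soloInformed_sa_bandUpper_toReal hB hξ j
  rintro (i | i | q)
  · exact (d i).a_sa
  · exact (IsSemialgebraicFunOn.sub_holds (d i).θ_sa d₀.θ_sa).congr fun _ _ => rfl
  · show IsSemialgebraicFunOn ℚ B (soloInformedBandEnds ξ j d₀.θ q)
    fin_cases q
    · exact (IsSemialgebraicFunOn.sub_holds hlo d₀.θ_sa).congr fun _ _ => rfl
    · exact (IsSemialgebraicFunOn.sub_holds hup d₀.θ_sa).congr fun _ _ => rfl
    · exact (IsSemialgebraicFunOn.sub_holds hup hlo).congr fun _ _ => rfl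

/-! ### The bundle -/

/-- **The hypothesis bundle over the base of a prepared band**: for integrands `H`, `H₀` agreeing
on the band with `F (1 + Σᵢ |log ρᵢ|)ᵖ` and `|F|`, the fibre quantities satisfy
`SoloInformedSideHyp` with the weights `σ`, the coefficient `a`, `Λ`, and the constants of the
fibre bound. -/
theorem soloInformed_band_sideHyp (hB : IsSemialgebraic ℚ B)
    (hξ : ∀ i, IsSemialgebraicFunOn ℚ B (ξ i)) (p : ℕ)
    (d₀ : SoloInformedLRData B (bandOver B ξ j) F) (d : ∀ i, SoloInformedLRData B (bandOver B ξ j) (ρ i))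
    {H H₀ : (Fin (n + 1) → ℝ) → ℝ≥0∞} (hHm : Measurable H) (hH₀m : Measurable H₀)
    (hH : ∀ z ∈ bandOver B ξ j, H z = ENNReal.ofReal (F z * (1 + ∑ i, |Real.log (ρ i z)|) ^ p))
    (hH₀ : ∀ z ∈ bandOver B ξ j, H₀ z = ENNReal.ofReal |F z|) :
    ∃ C : ℝ, 0 < C ∧ SoloInformedSideHyp B p (soloInformedBandSigma d₀ d) d₀.a
      (soloInformedBandHW B ξ j H) (soloInformedBandHW B ξ j H₀) (soloInformedBandI d₀)
      (soloInformedBandLambda d₀ d) C (4 + ∑ i, Real.log (d i).c) d₀.c := by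
  have hD : MeasurableSet (bandOver B ξ j) := (soloInformed_isSemialgebraic_bandOver hB hξ j).measurableSet_holds
  obtain ⟨C, hC, hfb⟩ := soloInformed_band_fibre_bound d₀ d p
  refine ⟨C, hC, ?_⟩
  exact {
    sa_P := hB
    sa_σ := soloInformed_sa_bandSigma hB hξ d₀ d
    sa_a := d₀.a_sa
    meas_HW := soloInformed_measurable_bandHW hD hHm
    meas_H₀ := soloInformed_measurable_bandHW hD hH₀m
    CW_nonneg := hC.le
    C₂_nonneg := by
      have : 0 ≤ ∑ i, Real.log (d i).c := Finset.sum_nonneg fun i _ => (d i).log_c_nonneg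
      linarith
    c_nonneg := zero_le_one.trans d₀.one_le_c
    hW := fun w hw => by
      rw [soloInformed_bandHW_congr hH hw, soloInformed_bandHW_congr hH₀ hw]
      exact hfb w hw
    hΛ := fun w hw => ⟨zero_le_one.trans (soloInformed_bandLambda_ge_one d₀ d w),
      soloInformed_bandLambda_le d₀ d w⟩
    hmass := fun w hw => by
      rw [soloInformed_bandHW_congr hH₀ hw]
      exact soloInformed_band_mass_bounds d₀ hw }

end Summit.KontsevichZagierPeriods.KontsevichZagierPeriods.Theorems
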